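/-
Copyright (c) 2026 the pub-hodgecm-mathlib formalisation cell (harness21).  Prover seat hodgecm-mathlib-LH4-p12 (g4), Track A «(D-RAM) FOUR-FRAME», unit U2H, the census leaf
(ρ2b′-X) `stub_U2H_fixedPointCensus_typeTwo_unit0` — PAYER-PLAN-rho2bX v2 brick T4 «order lattices» (dictionary D3–D4), part II: the LATTICES.  2026-09-04.
-/
import Literature.NumberTheory.LocalFields.QuadraticOrderIntegralBasis   -- ★ p857021 part I (same seat): coordinates, the orders `𝒪^ρ + c𝒪`, multiplier criterion, trace duals
import Literature.NumberTheory.Rogawski1990.TypeTwoEisensteinData        -- ★ `exists_v_eq_exp_neg_nat` (`0 < |x| ≤ 1 ⇒ |x| = exp(−k)`)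
import HarnessLib

/-!
# Mars' lattice lemma with NO hypothesis on `2`: every `𝒪_E`-lattice of a quadratic extension `M∕E` with an integral power basis is `z·(𝒪_E + c·𝒪_M)`; the
# `λ`-stable lattices are the `z·(𝒪_E + c𝒪_M)` with `λ ∈ 𝒪_E + c𝒪_M`; the trace dual of `z·(𝒪_E + c𝒪_M)` is `(z c(α − ρα))⁻¹·(𝒪_E + c𝒪_M)`
(Flicker 1998 p. 84 REMARK (J. G. M. Mars' lattice lemma); Serre, *Local Fields* Ch. III §6 Prop. 11–12)

Topic `NumberTheory/LocalFields`; namespace `Literature.NumberTheory.LocalFields.QuadraticOrder` (= ★ part I `QuadraticOrderIntegralBasis`).  THEOREMS ONLY (no definition,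
no instance, no notation, no named fact, no `sorry`); kernel lane `--supports stmt-HodgeConjecture-24833` (count-neutral).  Cell `pub/hodgecm-mathlib` (D-0151), crux H413,
Track A «(D-RAM) FOUR-FRAME», unit U2H: dictionary D3 of the toric ∕ order reduction of the WILD type-(2) fixed-point census (ρ2b′-X) (LH4-p12 (g3) PAYER-PLAN-rho2bX v2):
«`{Λ_W ⊂ W : gΛ_W = Λ_W} = {x·𝒪_j : 0 ≤ j ≤ j_λ, x ∈ M^×∕𝒪_j^×}`».  The ★ tame twins (`UnramifiedQuadraticOrderLattices`, `RamifiedQuadraticOrderLattices` §1) need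
`σa − a` a unit resp. `2` a unit; here the only input is the integral power basis `𝒪 = 𝒪^ρ ⊕ 𝒪^ρ·α` of part I (`hint : |z| ≤ 1 → |b(z)| ≤ 1`, `|α| ≤ 1`), which the
WILD ramified `M∕E` has (★ `WildQuadraticEisensteinFrame` (Π5)).

CURRENCY: as part I — `K` (model `M`) with `Valued K ℤᵐ⁰`, `ρ : K →+* K` an isometric involution, `b(z) = (z − ρz)∕(α − ρα)`, the order of conductor `c` (`c` fixed,
`0 < |c| ≤ 1`) = the spelled-out predicate `|z| ≤ 1 ∧ |z − ρz| ≤ |c(α − ρα)|`; a LATTICE is an additive subgroup `Λ ≤ K` stable under multiplication by FIXED INTEGERS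
(`hmul : ρ r = r → |r| ≤ 1 → x ∈ Λ → r·x ∈ Λ`), with bounded values, nonzero, and not inside a line `z·K^ρ`.

* §0 `hint` BY NAME: **`v_bCoord_le_one_of_even_log`** — in the RAMIFIED frames (base parity + `|α| = exp(−1)`) `hint` IS ★ (Π5) `v_fixed_add_fixed_mul_le_one_iff` ∘ ★
  `exists_fixed_coords_of_map_ne`; `v_bCoord_le_one_of_v_sub_map_eq_one` — in the UNRAMIFIED frame (`|α − ρα| = 1`) it is immediate.
* §1 **`exists_conductor_of_one_mem`** (MARS, normalised at `1 ∈ Λ ⊆ 𝒪`): `Λ` IS the order of conductor `c = b(x₀)`, `x₀ ∈ Λ` with `|b(x₀)|` largest (`⊆` by maximality;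
  `⊇`: `x = a(x) + (b(x)∕c)·(cα)` and `cα = x₀ − a(x₀) ∈ Λ`); **`exists_eq_mul_order`** (MARS, general position): `Λ = z·(order of conductor c)` with `z ∈ Λ` of largest
  value (normalise `z⁻¹Λ` and apply §1's first theorem).
* §2 **`forall_mul_mem_iff_of_eq_mul_order`**: for `Λ = z·(order of conductor c)`, `λΛ ⊆ Λ ⟺ λ` lies in the order of conductor `c` (`⟺ |λ| ≤ 1 ∧ |b(λ)| ≤ |c|`, part I) —
  the `λ`-stable lattices are exactly the `z·𝒪_j`, `j ≤ j_λ`.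
* §3 **`forall_v_trace_mul_le_one_iff_of_eq_mul_order`**: the trace dual of `Λ = z·(order of conductor c)` is `(z c(α − ρα))⁻¹·(order of conductor c)` (part I's Euler dual,
  translated by `z`).
HONEST LABEL: HC_CM is proved only modulo the 7 printed citations (2 remaining named inputs: hLiu418 = stmt-HodgeConjecture-24832, h413 = stmt-HodgeConjecture-24833) until rung 0
closes; unconditional local algebra, count-neutral (brick T4 of the (ρ2b′-X) payer plan, nothing more).

## References
* [Flicker1998UnitaryFL] Y. Z. Flicker, *Elementary proof of the fundamental lemma for a unitary group*, Canad. J. Math. 50 (1998), p. 84 REMARK (J. G. M. Mars: «`R(Λ) =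
  {x ∈ E ; xΛ ⊂ Λ}` is an order; the orders in `E` are `R_E(j) = R + π^j R_E` … if `R(Λ) = R_E(j)` then `Λ = z R_E(j)`»).
* [Serre1979] J.-P. Serre, *Local Fields*, GTM 67 (1979): Ch. III §6 Prop. 11 (codifferent of a power basis), Prop. 12 (integral power bases); Ch. II §1–§2.
-/

set_option autoImplicit false

open WithZero
open Literature.NumberTheory.Rogawski1990 (exists_v_eq_exp_neg_nat)

namespace Literature.NumberTheory.LocalFields.QuadraticOrder

/-! ## §0 The integral-power-basis hypothesis `hint` BY NAME from the ★ frames -/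

section Frames

variable {K : Type*} [Field K] [Valued K ℤᵐ⁰] {ρ : K →+* K}

/-- **`hint` IN THE RAMIFIED FRAMES (tame or wild) BY NAME from ★ (Π5)**: if `ρ`-fixed elements have EVEN order (base parity) and `α` is a uniformiser (`|α| = exp(−1)`), then
every integer `z` has `|b(z)| ≤ 1` — `z = a + b·α` by ★ `exists_fixed_coords_of_map_ne`, and ★ `v_fixed_add_fixed_mul_le_one_iff` reads `|z| ≤ 1` as `|a| ≤ 1 ∧ |b| ≤ 1`
(the Eisenstein uniformiser of ★ `WildQuadraticEisensteinFrame` at a wild `M∕E`; the anti-fixed uniformiser at a tame one). [cite: Serre1979, Ch. III §6 Prop. 12] -/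
theorem v_bCoord_le_one_of_even_log (hρρ : ∀ x, ρ (ρ x) = x) (hfix : ∀ c : K, ρ c = c → c ≠ 0 → Even (log (Valued.v c)))
    {α : K} (hvα : Valued.v α = exp (-1 : ℤ)) (hα : ρ α ≠ α) (z : K) (hz : Valued.v z ≤ 1) :
    Valued.v ((z - ρ z) / (α - ρ α)) ≤ 1 := by
  obtain ⟨a, b, ha, hb, rfl⟩ := exists_fixed_coords_of_map_ne hρρ hα z
  rw [bCoord_fixed_add_fixed_mul hα ha hb]
  exact ((v_fixed_add_fixed_mul_le_one_iff hfix hvα ha hb).1 hz).2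

/-- **`hint` IN THE UNRAMIFIED FRAME**: if `α − ρα` is a UNIT (`|α − ρα| = 1`; ★ `UnramifiedQuadraticOrderLattices`' token `IsUnit (σ a − a)`) and `ρ` is isometric, then every
integer `z` has `|b(z)| = |z − ρz| ≤ 1`. [cite: Serre1979, Ch. III §6 Prop. 12] -/
theorem v_bCoord_le_one_of_v_sub_map_eq_one (hvρ : ∀ x, Valued.v (ρ x) = Valued.v x) {α : K} (hδ : Valued.v (α - ρ α) = 1) (z : K) (hz : Valued.v z ≤ 1) :
    Valued.v ((z - ρ z) / (α - ρ α)) ≤ 1 := by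
  rw [map_div₀, hδ, div_one]
  exact (Valuation.map_sub _ _ _).trans (max_le hz (by rw [hvρ]; exact hz))

end Frames

/-! ## §1 Mars' lattice lemma with no hypothesis on `2` -/

section Mars

variable {K : Type*} [Field K] [Valued K ℤᵐ⁰] {ρ : K →+* K} {α : K}

/-- **MARS' LATTICE LEMMA, 2-FREE, NORMALISED AT `1 ∈ Λ ⊆ 𝒪`.**  Let `𝒪 = 𝒪^ρ ⊕ 𝒪^ρ·α` (`hint`, `|α| ≤ 1`).  An additive subgroup `Λ ⊆ 𝒪` containing `1`, stable under
multiplication by fixed integers and containing a non-fixed element is the ORDER of conductor `c := b(x₀)` for an `x₀ ∈ Λ` whose `b`-coordinate has the largest value: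
`x ∈ Λ ⟺ |x| ≤ 1 ∧ |x − ρx| ≤ |c(α − ρα)|` (`⊆`: maximality of `|b(x₀)|`; `⊇`: `x = a(x) + (b(x)∕c)·(cα)` and `cα = x₀ − a(x₀) ∈ Λ`).  Tame twins: ★
`UnramifiedQuadraticNorm.exists_forall_mem_iff_map_sub_self_mem_pow`, ★ `RamifiedQuadraticOrder.exists_forall_mem_iff_map_sub_self_mem_pow` (`2 ∈ 𝒪ˣ`).
[cite: Flicker1998UnitaryFL, p. 84 REMARK] [cite: Serre1979, Ch. III §6 Prop. 12] -/
theorem exists_conductor_of_one_mem (hρρ : ∀ x, ρ (ρ x) = x) (hα : ρ α ≠ α) (hα1 : Valued.v α ≤ 1)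
    (hint : ∀ z : K, Valued.v z ≤ 1 → Valued.v ((z - ρ z) / (α - ρ α)) ≤ 1)
    (Λ : AddSubgroup K) (hmul : ∀ r x, ρ r = r → Valued.v r ≤ 1 → x ∈ Λ → r * x ∈ Λ) (h1 : (1 : K) ∈ Λ)
    (hΛ1 : ∀ x ∈ Λ, Valued.v x ≤ 1) (hnf : ∃ x ∈ Λ, ρ x ≠ x) :
    ∃ c : K, ρ c = c ∧ c ≠ 0 ∧ Valued.v c ≤ 1 ∧
      ∀ x, x ∈ Λ ↔ (Valued.v x ≤ 1 ∧ Valued.v (x - ρ x) ≤ Valued.v (c * (α - ρ α))) := by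
  classical
  have hd : α - ρ α ≠ 0 := sub_ne_zero.2 (Ne.symm hα)
  -- fixed integers lie in `Λ`
  have hfix : ∀ r, ρ r = r → Valued.v r ≤ 1 → r ∈ Λ := fun r hr hr1 => by simpa using hmul r 1 hr hr1 h1
  -- the `b`-coordinates of non-fixed elements of `Λ` have values `exp(−n)`; take the LEAST `n`
  have hb0 : ∀ x, ρ x ≠ x → (x - ρ x) / (α - ρ α) ≠ 0 := fun x hx => div_ne_zero (sub_ne_zero.2 (Ne.symm hx)) hd
  have hP : ∃ n : ℕ, ∃ x ∈ Λ, ρ x ≠ x ∧ Valued.v ((x - ρ x) / (α - ρ α)) = exp (-(n : ℤ)) := by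
    obtain ⟨x, hx, hne⟩ := hnf
    obtain ⟨n, hn⟩ := exists_v_eq_exp_neg_nat (hb0 x hne) (hint x (hΛ1 x hx))
    exact ⟨n, x, hx, hne, hn⟩
  obtain ⟨x₀, hx₀, hne₀, hv₀⟩ := Nat.find_spec hP
  set n₀ := Nat.find hP with hn₀
  set c : K := (x₀ - ρ x₀) / (α - ρ α) with hc
  have hcfix : ρ c = c := map_bCoord hρρ α x₀
  have hc0 : c ≠ 0 := hb0 x₀ hne₀
  have hc1 : Valued.v c ≤ 1 := hint x₀ (hΛ1 x₀ hx₀)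
  -- `c·α = x₀ − a(x₀) ∈ Λ`
  have hcα : c * α ∈ Λ := by
    have h := Λ.sub_mem hx₀ (hfix _ (map_aCoord hρρ hα x₀) (v_aCoord_le_one hα1 hint (hΛ1 x₀ hx₀)))
    rwa [sub_sub_cancel] at h
  refine ⟨c, hcfix, hc0, hc1, fun x => ⟨fun hx => ?_, fun hx => ?_⟩⟩
  · -- `x ∈ Λ`: `|b(x)| ≤ |c|` by the minimality of `n₀`
    refine ⟨hΛ1 x hx, (v_sub_map_le_iff hα c x).2 ?_⟩
    by_cases hxf : ρ x = x
    · rw [hxf, sub_self, zero_div, map_zero]; exact zero_le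
    · obtain ⟨n, hn⟩ := exists_v_eq_exp_neg_nat (hb0 x hxf) (hint x (hΛ1 x hx))
      have hle : n₀ ≤ n := Nat.find_min' hP ⟨x, hx, hxf, hn⟩
      rw [hn, hv₀, exp_le_exp]; omega
  · -- `|x| ≤ 1`, `|b(x)| ≤ |c|`: `x = a(x) + q·(cα)` with `q = b(x)∕c` a fixed integer
    obtain ⟨hx1, hxc⟩ := hx
    have hb : Valued.v ((x - ρ x) / (α - ρ α)) ≤ Valued.v c := (v_sub_map_le_iff hα c x).1 hxc
    set q : K := (x - ρ x) / (α - ρ α) / c with hq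
    have hqfix : ρ q = q := by rw [hq, map_div₀, map_bCoord hρρ, hcfix]
    have hq1 : Valued.v q ≤ 1 := by rw [hq, map_div₀]; exact div_le_one_of_le₀ hb zero_le
    have hxdec : x = (x - (x - ρ x) / (α - ρ α) * α) + q * (c * α) := by
      rw [hq, ← mul_assoc, div_mul_cancel₀ _ hc0, sub_add_cancel]
    rw [hxdec]
    exact Λ.add_mem (hfix _ (map_aCoord hρρ hα x) (v_aCoord_le_one hα1 hint hx1)) (hmul q _ hqfix hq1 hcα)

/-- **MARS' LATTICE LEMMA, 2-FREE, GENERAL POSITION `Λ = z·(𝒪^ρ + c𝒪)`.**  A nonzero additive subgroup `Λ` with BOUNDED values, stable under the fixed integers and not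
contained in a line `z·K^ρ`, is `z·(order of conductor c)` for a `z ∈ Λ` of LARGEST value and a fixed `c` with `0 < |c| ≤ 1`:
`x ∈ Λ ⟺ ∃ y, (|y| ≤ 1 ∧ |y − ρy| ≤ |c(α − ρα)|) ∧ x = z·y`.  [cite: Flicker1998UnitaryFL, p. 84 REMARK] -/
theorem exists_eq_mul_order (hρρ : ∀ x, ρ (ρ x) = x) (hα : ρ α ≠ α) (hα1 : Valued.v α ≤ 1)
    (hint : ∀ z : K, Valued.v z ≤ 1 → Valued.v ((z - ρ z) / (α - ρ α)) ≤ 1)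
    (Λ : AddSubgroup K) (hmul : ∀ r x, ρ r = r → Valued.v r ≤ 1 → x ∈ Λ → r * x ∈ Λ)
    (hne : ∃ x ∈ Λ, x ≠ 0) (hbd : ∃ N : ℤ, ∀ x ∈ Λ, Valued.v x ≤ exp N)
    (hrk : ¬ ∃ z : K, ∀ x ∈ Λ, ∃ r, ρ r = r ∧ x = z * r) :
    ∃ z c : K, z ∈ Λ ∧ z ≠ 0 ∧ ρ c = c ∧ c ≠ 0 ∧ Valued.v c ≤ 1 ∧
      ∀ x, x ∈ Λ ↔ ∃ y, (Valued.v y ≤ 1 ∧ Valued.v (y - ρ y) ≤ Valued.v (c * (α - ρ α))) ∧ x = z * y := by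
  classical
  obtain ⟨N, hN⟩ := hbd
  -- an element `z ∈ Λ` of LARGEST value: values of nonzero elements are `exp(N − n)`, take the least `n`
  have hP : ∃ n : ℕ, ∃ x ∈ Λ, x ≠ 0 ∧ Valued.v x = exp (N - n) := by
    obtain ⟨x, hx, hx0⟩ := hne
    have hv0 : Valued.v x ≠ 0 := (Valuation.ne_zero_iff _).2 hx0
    obtain ⟨m, hm⟩ : ∃ m : ℤ, Valued.v x = exp m := ⟨_, (exp_log hv0).symm⟩
    have hmN : m ≤ N := by have := hN x hx; rwa [hm, exp_le_exp] at this
    refine ⟨(N - m).toNat, x, hx, hx0, ?_⟩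
    rw [hm, Int.toNat_of_nonneg (by omega)]; congr 1; ring
  obtain ⟨z, hz, hz0, hvz⟩ := Nat.find_spec hP
  set n₀ := Nat.find hP with hn₀
  have hmax : ∀ x ∈ Λ, Valued.v x ≤ Valued.v z := by
    intro x hx
    rcases eq_or_ne x 0 with rfl | hx0
    · rw [map_zero]; exact zero_le
    have hv0 : Valued.v x ≠ 0 := (Valuation.ne_zero_iff _).2 hx0
    obtain ⟨m, hm⟩ : ∃ m : ℤ, Valued.v x = exp m := ⟨_, (exp_log hv0).symm⟩
    have hmN : m ≤ N := by have := hN x hx; rwa [hm, exp_le_exp] at this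
    have hle : n₀ ≤ (N - m).toNat :=
      Nat.find_min' hP ⟨x, hx, hx0, by rw [hm, Int.toNat_of_nonneg (by omega)]; congr 1; ring⟩
    rw [hm, hvz, exp_le_exp]
    have := Int.toNat_of_nonneg (show 0 ≤ N - m by omega)
    omega
  have hvz0 : Valued.v z ≠ 0 := (Valuation.ne_zero_iff _).2 hz0
  -- the normalised lattice `Λ′ = z⁻¹Λ = {y : z·y ∈ Λ}`
  set Λ' : AddSubgroup K := Λ.comap (AddMonoidHom.mulLeft z) with hΛ'
  have hmem' : ∀ y, y ∈ Λ' ↔ z * y ∈ Λ := fun y => Iff.rfl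
  have hmul' : ∀ r x, ρ r = r → Valued.v r ≤ 1 → x ∈ Λ' → r * x ∈ Λ' := by
    intro r x hr hr1 hx
    rw [hmem'] at hx ⊢
    rw [mul_left_comm]; exact hmul r _ hr hr1 hx
  have h1' : (1 : K) ∈ Λ' := by rw [hmem', mul_one]; exact hz
  have hΛ1' : ∀ y ∈ Λ', Valued.v y ≤ 1 := by
    intro y hy
    rw [hmem'] at hy
    have h := hmax _ hy
    rw [map_mul] at h
    exact le_of_mul_le_mul_left (by rwa [mul_one]) (zero_lt_iff.2 hvz0)
  have hnf' : ∃ y ∈ Λ', ρ y ≠ y := by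
    by_contra hall
    refine hrk ⟨z, fun x hx => ⟨z⁻¹ * x, ?_, by rw [mul_inv_cancel_left₀ hz0]⟩⟩
    by_contra hfx
    exact hall ⟨z⁻¹ * x, by rw [hmem', mul_inv_cancel_left₀ hz0]; exact hx, hfx⟩
  obtain ⟨c, hcfix, hc0, hc1, hiff⟩ := exists_conductor_of_one_mem hρρ hα hα1 hint Λ' hmul' h1' hΛ1' hnf'
  refine ⟨z, c, hz, hz0, hcfix, hc0, hc1, fun x => ⟨fun hx => ?_, ?_⟩⟩
  · refine ⟨z⁻¹ * x, (hiff _).1 (by rw [hmem', mul_inv_cancel_left₀ hz0]; exact hx), by rw [mul_inv_cancel_left₀ hz0]⟩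
  · rintro ⟨y, hy, rfl⟩
    have := (hiff y).2 hy
    rwa [hmem'] at this

end Mars
/-! ## §2 Multipliers of a lattice `z·(order of conductor c)` -/

section Multipliers

variable {K : Type*} [Field K] [Valued K ℤᵐ⁰] {ρ : K →+* K} {α : K}

/-- **MULTIPLIER CRITERION FOR A LATTICE `Λ = z·(order of conductor c)`** (`z ≠ 0`): `λΛ ⊆ Λ ⟺ λ` lies in the order of conductor `c` — so the `λ`-STABLE lattices are
exactly the `z·𝒪_j` with `λ ∈ 𝒪_j`, i.e. `|b(λ)| ≤ |c|` (`j ≤ j_λ`). [cite: Flicker1998UnitaryFL, p. 84 REMARK] -/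
theorem forall_mul_mem_iff_of_eq_mul_order (hvρ : ∀ x, Valued.v (ρ x) = Valued.v x) {Λ : AddSubgroup K} {z c : K} (hz0 : z ≠ 0)
    (hΛ : ∀ x, x ∈ Λ ↔ ∃ y, (Valued.v y ≤ 1 ∧ Valued.v (y - ρ y) ≤ Valued.v (c * (α - ρ α))) ∧ x = z * y) (l : K) :
    (∀ x ∈ Λ, l * x ∈ Λ) ↔ (Valued.v l ≤ 1 ∧ Valued.v (l - ρ l) ≤ Valued.v (c * (α - ρ α))) := by
  constructor
  · intro h
    have hz : z ∈ Λ := (hΛ z).2 ⟨1, one_mem_order c, (mul_one z).symm⟩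
    obtain ⟨y, hy, hzy⟩ := (hΛ _).1 (h z hz)
    have hyl : y = l := mul_left_cancel₀ hz0 (by rw [← hzy, mul_comm])
    rwa [hyl] at hy
  · intro hl x hx
    obtain ⟨y, hy, rfl⟩ := (hΛ x).1 hx
    exact (hΛ _).2 ⟨l * y, mul_mem_order hvρ hl hy, by ring⟩

end Multipliers

/-! ## §3 The trace dual of a lattice `z·(order of conductor c)` -/

section Duals

variable {K : Type*} [Field K] [Valued K ℤᵐ⁰] {ρ : K →+* K} {α : K}

/-- **THE TRACE DUAL OF A LATTICE `Λ = z·(order of conductor c)`** (`z ≠ 0`): `y` pairs integrally with `Λ` iff `z·c(α − ρα)·y` lies in the order of conductor `c` —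
`Λ^* = (z c (α − ρα))⁻¹·(𝒪^ρ + c𝒪)`. [cite: Serre1979, Ch. III §6 Prop. 11] -/
theorem forall_v_trace_mul_le_one_iff_of_eq_mul_order (hρρ : ∀ x, ρ (ρ x) = x) (hvρ : ∀ x, Valued.v (ρ x) = Valued.v x) (hα : ρ α ≠ α)
    (hα1 : Valued.v α ≤ 1) (hint : ∀ z : K, Valued.v z ≤ 1 → Valued.v ((z - ρ z) / (α - ρ α)) ≤ 1)
    {c : K} (hc : ρ c = c) (hc0 : c ≠ 0) (hc1 : Valued.v c ≤ 1) {Λ : AddSubgroup K} {z : K}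
    (hΛ : ∀ x, x ∈ Λ ↔ ∃ y, (Valued.v y ≤ 1 ∧ Valued.v (y - ρ y) ≤ Valued.v (c * (α - ρ α))) ∧ x = z * y) (y : K) :
    (∀ x ∈ Λ, Valued.v (x * y + ρ (x * y)) ≤ 1) ↔
      (Valued.v (c * (α - ρ α) * (z * y)) ≤ 1 ∧
        Valued.v (c * (α - ρ α) * (z * y) - ρ (c * (α - ρ α) * (z * y))) ≤ Valued.v (c * (α - ρ α))) := by
  rw [← forall_v_trace_mul_le_one_iff hρρ hvρ hα hα1 hint hc hc0 hc1 (z * y)]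
  constructor
  · intro h x hx
    have := h (z * x) ((hΛ _).2 ⟨x, hx, rfl⟩)
    rw [mul_assoc] at this
    rwa [mul_left_comm]
  · intro h x hx
    obtain ⟨w, hw, rfl⟩ := (hΛ x).1 hx
    rw [mul_assoc, mul_left_comm]
    exact h w hw

end Duals

end Literature.NumberTheory.LocalFields.QuadraticOrder
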